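import Summits.QuantumFields.YangMills.Theorems.TwistedTraceScaling.Negative.WindowFloorTransfer
import Summits.QuantumFields.YangMills.Theorems.LuscherReductionTwistedTraceScalingBaseOfWindow
import Summits.QuantumFields.YangMills.Theorems.LuscherReductionRunningReductionOneSiteTailClosed
import HarnessLib

/-!
# W(L) from the lead's cut (★) BO-WINDOW(L) — the last brick W7 of `Lines-window-floor.md` is already here — crux disprover, cycle 61
# (route `LuscherReduction`, crux `TwistedTraceScaling` stmt-QuantumFields-20203, skeleton «twolattice» rev 3, stub S-BASE; `--supports`, helper only)

Lead g24's design of record (`pub/ym-fleet/ym-luscher-20007-p1/Lines-window-floor.md` §2) cuts the window floor W(L) at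

  `(★) BO-WINDOW(L) : ∀ c > 0, ∀ ε > 0, ∃ β₀, ∀ β ≥ β₀, ∀ k, λ_k(β,L)·μ₀ ≤ (max μ_k (e^{−(c log β)λ_b}·μ₀) + ε·λ_b·μ₀)·λ₀(β,L)`
  (`μ_j = levelValue su2Rep 1 (L³β) j`, `λ_b = bareLambda (L³β)`),

and plans W7 `…WindowFloor` = (★) + ✓`OST.windowFloor_all` at `B = L³β` + labels + arithmetic.  This file IS that step, on top of R74a
(`…Negative.WindowFloorTransfer`): ★ `windowFloor_text_of_boWindow : (★ with ∃ ε) → W(L)` and `windowFloor_text_of_boWindow_forall` (the card's `∀ ε > 0` shape), and the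
composite ★★ `base_stmt_of_boWindow : (∀ L ≥ 2, (★)(L)) → S-BASE's registered stub body` through ✓`Base.stmt_of_window`.  Two remarks the typing makes precise:
(i) (★) is UBO-CAP(L) of R74a with the guard `∀ j < k reference-low` DROPPED (so (★) is formally stronger than W needs — true on paper all the same, the unguarded levels
only meet the cap clause) and with ADDITIVE slack `ε λ_b μ₀`, which is converted to the multiplicative `e^{2ελ_b}` once `(c log β)·λ_b(L³β) ≤ log 2`
(✓`OST.log_mul_bareLambda_le`; `max_add_le_exp_mul_max`); (ii) ONE `ε` per cap suffices (`∃ ε`, even `ε = 1`): the `∀ ε > 0` of (★) is not load-bearing for W (R74a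
`windowFloor_text_of_slack`), so W3/W6 may run at a fixed slack.
HONEST FRAMING: glue about an OPEN hypothesis text (W(L)) of a stub (S-BASE) of a child of the CONDITIONAL reduction route R2b1 (femto rung); (★) is OPEN (lead's W2–W6);
nothing here proves W(L), S-BASE or the crux; not infinite volume, not a mass gap, not Clay.
-/

set_option autoImplicit false

noncomputable section

open MeasureTheory Filter Topology Real
open scoped BigOperators
open Literature.MathematicalPhysics.QuantumFieldTheory hiding SU2
open Literature.MathematicalPhysics.QuantumLattice
open Summit.QuantumFields.YangMills.Theorems.FemtoTransferGap

namespace Summit.QuantumFields.YangMills.Theorems.TwistedTraceScaling.Negative.R74c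

/-- Additive slack → multiplicative slack under a floor on the threshold: `max M thr + ε v μ₀ ≤ e^{2εv}·max M thr` once `μ₀ ≤ 2·thr`. [folklore] -/
theorem max_add_le_exp_mul_max {M thr μ0 ε v : ℝ} (hthr : μ0 ≤ 2 * thr) (hε : 0 ≤ ε) (hv : 0 ≤ v) (hμ0 : 0 ≤ μ0) :
    max M thr + ε * v * μ0 ≤ Real.exp (2 * ε * v) * max M thr := by
  have h1 : thr ≤ max M thr := le_max_right _ _
  have hmax0 : 0 ≤ max M thr := by linarith
  have h2 : ε * v * μ0 ≤ ε * v * (2 * max M thr) :=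
    mul_le_mul_of_nonneg_left (hthr.trans (by linarith)) (mul_nonneg hε hv)
  have h3 : 2 * ε * v + 1 ≤ Real.exp (2 * ε * v) := Real.add_one_le_exp _
  calc max M thr + ε * v * μ0 ≤ max M thr + ε * v * (2 * max M thr) := by linarith
    _ = (2 * ε * v + 1) * max M thr := by ring
    _ ≤ Real.exp (2 * ε * v) * max M thr := mul_le_mul_of_nonneg_right h3 hmax0

section Levels

variable (L : ℕ) [NeZero L]

/-- `(c·log β)·λ_b(L³β) ≤ log 2` for all large `β` (from ✓`OST.log_mul_bareLambda_le` at `B = L³β ≥ β`). [folklore] -/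
theorem eventually_cap_mul_bareLambda_le_log_two {c : ℝ} (hc : 0 < c) :
    ∃ β0 : ℝ, ∀ β : ℝ, β0 ≤ β → 1 ≤ β ∧ c * Real.log β * bareLambda ((L : ℝ) ^ 3 * β) ≤ Real.log 2 := by
  have hl2 : 0 < Real.log 2 := Real.log_pos (by norm_num)
  obtain ⟨T, hT1, hT⟩ := OST.log_mul_bareLambda_le (c := Real.log 2 / c) (by positivity)
  have hL1 : (1 : ℝ) ≤ L := by exact_mod_cast NeZero.one_le
  have hL3 : (1 : ℝ) ≤ (L : ℝ) ^ 3 := one_le_pow₀ hL1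
  refine ⟨max T 1, fun β hβ => ?_⟩
  have hβ1 : 1 ≤ β := le_trans (le_max_right _ _) hβ
  have hβT : T ≤ β := le_trans (le_max_left _ _) hβ
  have hβpos : 0 < β := by linarith
  have hBβ : β ≤ (L : ℝ) ^ 3 * β := by nlinarith
  have hB1 : 1 ≤ (L : ℝ) ^ 3 * β := hβ1.trans hBβ
  have hBT : T ≤ (L : ℝ) ^ 3 * β := hβT.trans hBβ
  have hlam : 0 < bareLambda ((L : ℝ) ^ 3 * β) := bareLambda_pos' (by positivity)
  have hlog : Real.log β ≤ Real.log ((L : ℝ) ^ 3 * β) := Real.log_le_log hβpos hBβ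
  have h1 := hT _ hBT
  have h2 : ((L : ℝ) ^ 3 * β) ^ (-(1 / 4 : ℝ)) ≤ 1 := Real.rpow_le_one_of_one_le_of_nonpos hB1 (by norm_num)
  have h3 : Real.log ((L : ℝ) ^ 3 * β) * bareLambda ((L : ℝ) ^ 3 * β) ≤ Real.log 2 / c := by
    refine h1.trans ?_
    have := mul_le_mul_of_nonneg_left h2 (div_pos hl2 hc).le
    linarith
  refine ⟨hβ1, ?_⟩
  have h4 : Real.log β * bareLambda ((L : ℝ) ^ 3 * β) ≤ Real.log 2 / c :=
    (mul_le_mul_of_nonneg_right hlog hlam.le).trans h3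
  have h5 := mul_le_mul_of_nonneg_left h4 hc.le
  rw [mul_div_cancel₀ _ hc.ne'] at h5
  linarith [h5]

/-- ★ **W(L) from (★) BO-WINDOW(L)** (with `∃ ε` per cap — one fixed slack suffices).  The lead's W7 on top of R74a: convert the additive slack to `e^{2ελ_b}`
(threshold `e^{−(c log β)λ_b}μ₀ ≥ μ₀/2` once `(c log β)λ_b ≤ log 2`), drop into `R74.windowFloor_text_of_uboCap` (its guard is simply not used). [cite: Luscher1983, §3]
[cite: ReedSimonIV1978, Thm. XIII.1] -/
theorem windowFloor_text_of_boWindow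
    (hBOW : ∀ c : ℝ, 0 < c → ∃ ε : ℝ, ∃ β0 : ℝ, ∀ β : ℝ, β0 ≤ β → ∀ k : ℕ,
      levelValue su2Rep L β k * levelValue su2Rep 1 ((L : ℝ) ^ 3 * β) 0 ≤
        (max (levelValue su2Rep 1 ((L : ℝ) ^ 3 * β) k)
            (Real.exp (-(c * Real.log β * bareLambda ((L : ℝ) ^ 3 * β))) * levelValue su2Rep 1 ((L : ℝ) ^ 3 * β) 0) +
          ε * bareLambda ((L : ℝ) ^ 3 * β) * levelValue su2Rep 1 ((L : ℝ) ^ 3 * β) 0) * levelValue su2Rep L β 0) :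
    ∀ c₁ : ℝ, 0 < c₁ → ∃ g : ℕ → ℝ, (∀ k, 0 ≤ g k) ∧
      (∀ t : ℝ, 0 < t → Summable fun k : ℕ => Real.exp (-t * g k)) ∧
      ∃ β0 : ℝ, ∀ β : ℝ, β0 ≤ β → ∀ k : ℕ,
        levelValue su2Rep L β k ≤
          Real.exp (-(luscherLambda β L / L * min (g k) (c₁ * Real.log β))) * levelValue su2Rep L β 0 := by
  refine R74.windowFloor_text_of_uboCap L fun c hc => ?_
  obtain ⟨ε, β0, h⟩ := hBOW c hc
  obtain ⟨β1, h1⟩ := eventually_cap_mul_bareLambda_le_log_two L hc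
  refine ⟨2 * max ε 0, max β0 β1, fun β hβ k _ => ?_⟩
  have hβ0 : β0 ≤ β := le_trans (le_max_left _ _) hβ
  obtain ⟨hβ1, hcap⟩ := h1 β (le_trans (le_max_right _ _) hβ)
  have hβpos : 0 < β := by linarith
  have hL : (0 : ℝ) < L := by exact_mod_cast Nat.pos_of_ne_zero (NeZero.ne L)
  set B : ℝ := (L : ℝ) ^ 3 * β with hB
  have hBpos : 0 < B := by positivity
  set v : ℝ := bareLambda B with hv
  have hvpos : 0 < v := bareLambda_pos' hBpos
  set μ0 : ℝ := levelValue su2Rep 1 B 0 with hμ0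
  have hμ0pos : 0 < μ0 := levelValue_zero_su2Rep_pos 1 B
  have hl0 : 0 ≤ levelValue su2Rep L β 0 := (levelValue_su2Rep_pos hβpos 0).le
  set thr : ℝ := Real.exp (-(c * Real.log β * v)) * μ0 with hthr
  -- threshold floor `μ₀ ≤ 2·thr`
  have hthr2 : μ0 ≤ 2 * thr := by
    have e1 : (1 / 2 : ℝ) ≤ Real.exp (-(c * Real.log β * v)) := by
      have e2 : Real.exp (-Real.log 2) = 1 / 2 := by
        rw [Real.exp_neg, Real.exp_log (by norm_num : (0 : ℝ) < 2)]; norm_num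
      rw [← e2, Real.exp_le_exp]
      linarith
    rw [hthr]
    nlinarith
  -- (★) at `k`, slack enlarged to `max ε 0`
  have hk := h β hβ0 k
  have hk' : levelValue su2Rep L β k * μ0 ≤
      (max (levelValue su2Rep 1 B k) thr + max ε 0 * v * μ0) * levelValue su2Rep L β 0 := by
    refine hk.trans (mul_le_mul_of_nonneg_right ?_ hl0)
    have : ε * v * μ0 ≤ max ε 0 * v * μ0 :=
      mul_le_mul_of_nonneg_right (mul_le_mul_of_nonneg_right (le_max_left _ _) hvpos.le) hμ0pos.le
    linarith
  have hconv := max_add_le_exp_mul_max (M := levelValue su2Rep 1 B k) hthr2 (le_max_right ε 0) hvpos.le hμ0pos.le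
  have hthr' : thr = Real.exp (-(v * (c * Real.log β))) * μ0 := by
    rw [hthr]; ring_nf
  calc levelValue su2Rep L β k * μ0
      ≤ (max (levelValue su2Rep 1 B k) thr + max ε 0 * v * μ0) * levelValue su2Rep L β 0 := hk'
    _ ≤ (Real.exp (2 * max ε 0 * v) * max (levelValue su2Rep 1 B k) thr) * levelValue su2Rep L β 0 :=
        mul_le_mul_of_nonneg_right hconv hl0
    _ = Real.exp (2 * max ε 0 * v) * (levelValue su2Rep L β 0 *
          max (levelValue su2Rep 1 B k) (Real.exp (-(v * (c * Real.log β))) * μ0)) := by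
        rw [← hthr']; ring

/-- The card's literal shape (`∀ ε > 0, ∃ β₀`): a fortiori. -/
theorem windowFloor_text_of_boWindow_forall
    (hBOW : ∀ c : ℝ, 0 < c → ∀ ε : ℝ, 0 < ε → ∃ β0 : ℝ, ∀ β : ℝ, β0 ≤ β → ∀ k : ℕ,
      levelValue su2Rep L β k * levelValue su2Rep 1 ((L : ℝ) ^ 3 * β) 0 ≤
        (max (levelValue su2Rep 1 ((L : ℝ) ^ 3 * β) k)
            (Real.exp (-(c * Real.log β * bareLambda ((L : ℝ) ^ 3 * β))) * levelValue su2Rep 1 ((L : ℝ) ^ 3 * β) 0) +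
          ε * bareLambda ((L : ℝ) ^ 3 * β) * levelValue su2Rep 1 ((L : ℝ) ^ 3 * β) 0) * levelValue su2Rep L β 0) :
    ∀ c₁ : ℝ, 0 < c₁ → ∃ g : ℕ → ℝ, (∀ k, 0 ≤ g k) ∧
      (∀ t : ℝ, 0 < t → Summable fun k : ℕ => Real.exp (-t * g k)) ∧
      ∃ β0 : ℝ, ∀ β : ℝ, β0 ≤ β → ∀ k : ℕ,
        levelValue su2Rep L β k ≤
          Real.exp (-(luscherLambda β L / L * min (g k) (c₁ * Real.log β))) * levelValue su2Rep L β 0 :=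
  windowFloor_text_of_boWindow L fun c hc =>
    let ⟨β0, h⟩ := hBOW c hc 1 one_pos
    ⟨1, β0, h⟩

end Levels

/-- ★★ **S-BASE ⟸ ∀ L ≥ 2, (★) BO-WINDOW(L)**: composite with ✓`Base.stmt_of_window` — the conclusion is the registered body of `stub_fixedLatticeTraceLaw`.
So the line's remaining work for S-BASE is exactly the lead's W2–W6 (the `k`-uniform BO upper comparison at fixed slack); W7 is this theorem. [cite: Luscher1983, §3] -/
theorem base_stmt_of_boWindow
    (hBOW : ∀ (L : ℕ) [NeZero L], 2 ≤ L → ∀ c : ℝ, 0 < c → ∀ ε : ℝ, 0 < ε → ∃ β0 : ℝ, ∀ β : ℝ, β0 ≤ β → ∀ k : ℕ,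
      levelValue su2Rep L β k * levelValue su2Rep 1 ((L : ℝ) ^ 3 * β) 0 ≤
        (max (levelValue su2Rep 1 ((L : ℝ) ^ 3 * β) k)
            (Real.exp (-(c * Real.log β * bareLambda ((L : ℝ) ^ 3 * β))) * levelValue su2Rep 1 ((L : ℝ) ^ 3 * β) 0) +
          ε * bareLambda ((L : ℝ) ^ 3 * β) * levelValue su2Rep 1 ((L : ℝ) ^ 3 * β) 0) * levelValue su2Rep L β 0) :
    ∀ (L1 : ℕ) [NeZero L1] (s : ℝ), 0 < s → ∀ ε : ℝ, 0 < ε → ∃ β1 : ℝ, ∀ β : ℝ, β1 ≤ β →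
      |TraceDoor.traceRatio L1 β (TraceDoor.femtoSteps s β L1) - TraceDoor.hTraceRatio s| ≤ ε :=
  TwoLattice.Base.stmt_of_window fun L _ hL => windowFloor_text_of_boWindow_forall L (hBOW L hL)

end Summit.QuantumFields.YangMills.Theorems.TwistedTraceScaling.Negative.R74c

end
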